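/-
Copyright (c) 2026 the pub-hodgecm-mathlib formalisation cell (harness21).  Prover seat hodgecm-mathlib-LH4-p15 (g0), req620 Track A «(D-RAM) FOUR-FRAME» squad
((β₂) road (R-36) «PURE-CELL LEDGER»; β₂-BOARD HANDOFF-beta2cells v1 (LH4-p04 (g8)) §OPEN «hdich at shallow axis levels (p15 face)»; (AX-sh) HEAD = the `hdich` binder of
★ p862003 `F0P3cDyRamAxisColumnZero` ∕ ★ p862391 `F0P3cDyRamAxisColumnZeroOfFrame` (LH4-p12 (g8)) on the whole axis column, lanes A∕B), 2026-09-04.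
-/
import Summits.HodgeConjecture.HodgeConjecture.Theorems.F0P3cDyRamAxisLetterEstimates   -- ★ (this seat, (AX-sh) 2∕3): `exists_fixed_unit_lineValueSet_axis_eq_smul_xPlus`; brings ★ p861372 HEAD A, ★ p861579 `forall_smul_mulVec_mem_iff_isOrd`∕`mem_iff_map_mem`∕`isOrd_one`, ★ (E1) plane iffs
import Summits.HodgeConjecture.HodgeConjecture.Theorems.F0P3cDyRamAxisColumnZero        -- ★ p862003 (LH4-p12 (g8)): `v_pairing_self_le_one_of_mem_levelSet`, `map_planeMatrix_latt_eq_inf_ker`; brings ★ Lit `mem_latt_endoGL_one_iff`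
import Summits.HodgeConjecture.HodgeConjecture.Theorems.F0P3cDyRamStageOneBDefs          -- ★ №6 DEFS: `mcOfRecord`
import HarnessLib

/-!
# Crux `H413`, line LH4 «(D-RAM) FOUR-FRAME» — STAGE-1b, row (2), the (β₂) road (R-36), row (AX-sh) HEAD: «THE `hdich` OF (AX-0) HOLDS ON THE WHOLE AXIS COLUMN» —
# for every order level `j` and every axis vertex `latt ι(g₂, 1)` over a member of `levelSet ρ Θ α (jE ϖ) h j 0` on the near-transvection shell `(d % 2, mcOfRecord d)`,
# the `m*`-letter is `valueSetMod σ ϖ m* (e • X₊)` for a `σ`-FIXED UNIT `e` (lanes A∕B: `|α − ρα| = 1`); ★ p862003's `hdich` binder, byte shape, at `a = 0`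

Cell `hodgecm-mathlib` (D-0151), FLOOR 0, crux item H413 = `stmt-HodgeConjecture-24833`, route of record `HCCMUnconditional`; squad F0∕P3c∕LH4; lane
`--supports stmt-HodgeConjecture-24833 --as helper` (count-neutral; pays NO tier-0 row).  THEOREMS ONLY (no `def`, no instance, no notation, no `sorry`, default heartbeats);
★-only imports; states NO law; (β₂) stays a HYPOTHESIS.  DATUM-FREE over ★ (C1)'s block-frame binders exactly as in ★ p862003 (`H₂, hW, Γ = ι(γ₂, u)`, `hum`, the line
model `φ jE ρ Θ α lam h` with `hφs hφi hφγ hform` and the ★ DEFS `ρ∕Θ` letters), plus four letters of the lane files `beta2CellsAFrame` ∕ `beta2CellsBNear` (LH4-p12 (g8)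
22:11:49Z «all BNear∕AFrame letters ✓»): `Θ h = h`, `Θ lam·lam = 1`, `|α − ρα| = 1`, `|jE a| = |a|`; and `2 ≤ d` (dyadic datum, ★ `two_le_d_of_v_two_lt_one`).

WHY (HANDOFF-beta2cells v1 (LH4-p04 (g8), 61f6486f) §OPEN «hdich at shallow axis levels (p15 face)»; LH4-p04 16:28:43Z (AX-sh); LH4-p12 (g8) ★ p862391 `…AxisColumnZeroOfFrame`:
«ONE named binder left per literal: `hdich` (p15)»).  ★ p862003 (AX-0) makes the axis cell difference vanish modulo `hclean` (★ p861941 ∕ ★ p862391 `hclean_axis_of_frame`) and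
`hdich`; ★ p862010 (LH4-p13) gives `hdich` at DEEP order only.  THIS FILE proves `hdich` at EVERY order level from the cell membership and the shell token alone: by ★ (AX-sh) 2∕3
`exists_fixed_unit_lineValueSet_axis_eq_smul_xPlus` the line-model value set of a unimodular axis line on the clean shell is one class (skew gain of the ramified datum + the lower
and square tokens), and §1–§2 here are the dictionary from ★ p862003's lattice letters to those line-model letters:
* §1 `isOrd_tokens_of_shell` — the shell `LatticeNearTransvShell ϖ (d % 2) (mcOfRecord d) (Γ − 1) (latt ι(g₂, 1))` over `Λ = φ(latt g₂) = x₀·𝒪_j` read as the three order tokens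
  `(lam − 1)∕ϖE^{ℓ₀} ∈ 𝒪_j`, `(lam − 1)∕ϖE^{ℓ₀+1} ∉ 𝒪_j`, `(lam − 1)²∕ϖE^{m_c} ∈ 𝒪_j` (★ (E1) `forall_endoGL_sub_one[_sq]_mulVec_mem_scaleLattice_iff_plane` at the axis presentation
  `b = 0, w₀ = 0, x₀ = e_W` + ★ p861579 `forall_smul_mulVec_mem_iff_isOrd`; the `u`-clauses by `hum`, `m* ≥ ℓ₀ + 1`).
* §2 `valueSet_axis_eq_lineValueSet` — ★ p861372 HEAD A at the axis presentation: the `m*`-letter of `latt ι(g₂, 1)` is `{z ∣ ∃ ζ ∈ 𝒪_j, |(ϖE^{m*})⁻¹(jE z − Tr_ρ(κμ·ζΘζ))| ≤ 1}`,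
  `κ = h·N_Θ x₀`, `μ = lam − jE u₀₀` (vertex integrality ★ p862003 `v_pairing_self_le_one_of_mem_levelSet`).
* §3 HEAD `exists_fixed_unit_valueSet_axis_eq_smul_xPlus` — ★ p862003's `hdich` binder at `(ℓ, mc, a) = (d % 2, mcOfRecord d, 0)`; the `κ`-letters (`Θκ = κ`, `|κ + ρκ| ≤ 1`,
  `|κ|·|ϖE|^j = 1`) from `|Y| = 1`, `Y ∈ 𝒪_j` of the cell; the six inequalities of ★ 2∕3 at `m = m*`, `2k = m_c` by `omega` (`d ≥ 2`).
HONEST LABEL.  Count-neutral lattice ∕ order algebra; nothing printed is asserted; no census law is stated; (AX-0)'s sum and (β₂) stay exactly as ★ p862391 ∕ the typed letters leave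
them; `HC_CM` is proved only modulo the 7 printed citations (2 remaining named inputs: hLiu418 = `stmt-HodgeConjecture-24832`, h413 = `stmt-HodgeConjecture-24833`) until rung 0 closes.
## References
* [Rogawski1990] J. D. Rogawski, *Automorphic Representations of Unitary Groups in Three Variables*, Ann. of Math. Stud. 123 (1990): §4.9 Prop. 4.9.1 (b) p. 55.
* [Jacobowitz1962] R. Jacobowitz, *Hermitian forms over local fields*, Amer. J. Math. 84 (1962): §4 (unimodular hermitian lines; duals and gluing).
* [Kottwitz1986BaseChangeUnits] R. E. Kottwitz, *Base change for unit elements of Hecke algebras*, Compositio Math. 60 (1986): §1 pp. 240–241, §3 (congruence levels on lattices).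
* [Serre1979] J.-P. Serre, *Local Fields*, GTM 67 (1979): Ch. III §3 Prop. 7, §6 Prop. 12–13; Ch. V §3 Cor. 3.
-/

set_option autoImplicit false

noncomputable section

namespace Summit.HodgeConjecture.HodgeConjecture.Cruxes.H413.F0P3cDyRamAxisLetterOneClass

open scoped Valued WithZero Matrix MatrixGroups
open WithZero
open Literature.NumberTheory.Automorphic Literature.NumberTheory.Automorphic.HermitianLattice Literature.NumberTheory.Automorphic.UnitaryLatticeTree
open Literature.NumberTheory.Automorphic.UnitaryThreeFourFrame (IsRamifiedQuadraticDatum)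
open Literature.NumberTheory.Rogawski1990
open Literature.NumberTheory.LocalFields.WildQuadraticDatum (v_varpi_pow)
open Summit.HodgeConjecture.HodgeConjecture.Cruxes.H413.F0P3cDyRamFourFramePieces
open Summit.HodgeConjecture.HodgeConjecture.Cruxes.H413.F0P3cDyRamFourFrameCensusDefs (LatticeInLevel LatticeNearTransvShell)
open Summit.HodgeConjecture.HodgeConjecture.Cruxes.H413.F0P3cDyRamStageOneBDefs (mcOfRecord)
open Summit.HodgeConjecture.HodgeConjecture.Cruxes.H413.F0P3cDyRamToricCensusDefs
open Summit.HodgeConjecture.HodgeConjecture.Cruxes.H413.F0P3cDyRamProfileCountCentralRescaling (latticeInLevel_iff_forall)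
open Summit.HodgeConjecture.HodgeConjecture.Cruxes.H413.F0P3cDyRamShellLineModel (forall_smul_mulVec_mem_iff_isOrd mem_iff_map_mem isOrd_one)
open Summit.HodgeConjecture.HodgeConjecture.Cruxes.H413.F0P3cDyRamDepthFormLineModel (valueSet_endoGL_sub_one_glued_eq_lineModelSet_of_v_sub_one_le)
open Summit.HodgeConjecture.HodgeConjecture.Cruxes.H413.F0P3cDyRamAxisColumnZero (v_pairing_self_le_one_of_mem_levelSet map_planeMatrix_latt_eq_inf_ker)
open Summit.HodgeConjecture.HodgeConjecture.Cruxes.H413.F0P3cDyRamAxisLetterToolkit (v_map_varpi_pow)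
open Summit.HodgeConjecture.HodgeConjecture.Cruxes.H413.F0P3cDyRamAxisLetterEstimates (exists_fixed_unit_lineValueSet_axis_eq_smul_xPlus)

variable {E : Type} {M : Type*} [Field E] [Valued E ℤᵐ⁰] [Field M] [Valued M ℤᵐ⁰] {σ : E →+* E} {ϖ : E} {d t : ℕ} {ρ Θ : M →+* M} {α : M}

/-! ## §1 The shell of the axis vertex, read as order tokens of `lam − 1` -/

omit [Field M] [Valued M ℤᵐ⁰] in
/-- The axis presentation of `latt ι(g₂, 1)`: line coordinate token (`b = 0`), the generator `e_W`, and its projection. [cite: Jacobowitz1962, §4] -/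
theorem axis_presentation (ϖ : E) (g₂ : GL (Fin 2) E) :
    (∀ a : E, (Pi.single 1 a : Fin 3 → E) ∈ latt ((endoGL (g₂, (1 : GL (Fin 1) E)) : GL (Fin 3) E) : Matrix (Fin 3) (Fin 3) E) ↔ Valued.v a ≤ Valued.v ϖ ^ 0) ∧
    (∀ x ∈ latt ((endoGL (g₂, (1 : GL (Fin 1) E)) : GL (Fin 3) E) : Matrix (Fin 3) (Fin 3) E), Valued.v (x 1) * Valued.v ϖ ^ 0 ≤ 1) ∧
    (Pi.single 1 1 : Fin 3 → E) ∈ latt ((endoGL (g₂, (1 : GL (Fin 1) E)) : GL (Fin 3) E) : Matrix (Fin 3) (Fin 3) E) ∧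
    Valued.v ((Pi.single 1 1 : Fin 3 → E) 1) * Valued.v ϖ ^ 0 = 1 ∧
    (Pi.single 1 1 : Fin 3 → E) - Pi.single 1 ((Pi.single 1 1 : Fin 3 → E) 1) = ![(0 : Fin 2 → E) 0, 0, (0 : Fin 2 → E) 1] := by
  have hsingle : ∀ a : E, (![(Pi.single 1 a : Fin 3 → E) 0, (Pi.single 1 a : Fin 3 → E) 2] : Fin 2 → E) = 0 := fun a => by
    ext i; fin_cases i <;> simp
  refine ⟨fun a => ?_, fun x hx => ?_, ?_, by simp, by ext i; fin_cases i <;> simp⟩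
  · rw [mem_latt_endoGL_one_iff, hsingle, pow_zero]
    exact ⟨fun h => by simpa using h.2, fun h => ⟨Submodule.zero_mem _, by simpa using h⟩⟩
  · rw [pow_zero, mul_one]; exact ((mem_latt_endoGL_one_iff g₂ x).1 hx).2
  · rw [mem_latt_endoGL_one_iff, hsingle]
    exact ⟨Submodule.zero_mem _, by simp⟩

/-- **THE SHELL OF THE AXIS VERTEX AS ORDER TOKENS.**  In ★ (C1)'s line model (`φ` injective `jE`-semilinear, `φ(γ₂x) = lam·φx`), for a block element `Γ = ι(γ₂, u)` with
`|u₀₀ − 1| ≤ |ϖ^{m*}|` and a plane lattice with `φ(latt g₂) = x₀·𝒪_j` (`x₀ ≠ 0`): the shell token `LatticeNearTransvShell ϖ (d % 2) (mcOfRecord d) (Γ − 1) (latt ι(g₂, 1))` yields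
`(lam − 1)∕ϖE^{d % 2} ∈ 𝒪_j`, `(lam − 1)∕ϖE^{d % 2 + 1} ∉ 𝒪_j` and `(lam − 1)²∕ϖE^{mcOfRecord d} ∈ 𝒪_j` (`ϖE = jE ϖ`; ★ (E1) plane iffs at `b = 0, w₀ = 0, x₀ = e_W` + ★ p861579).
[cite: Kottwitz1986BaseChangeUnits, §3] [cite: Serre1979, Ch. III §6 Prop. 12] -/
theorem isOrd_tokens_of_shell {ϖ : E} (hϖ : Valued.v ϖ = exp (-1 : ℤ)) {d : ℕ} (h1d : 1 ≤ d) (hvρ : ∀ x, Valued.v (ρ x) = Valued.v x) (jE : E →+* M)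
    (φ : (Fin 2 → E) →+ M) (hφs : ∀ (c : E) (x : Fin 2 → E), φ (c • x) = jE c * φ x) (hφi : Function.Injective φ)
    {γ₂ : GL (Fin 2) E} {lam : M} (hφγ : ∀ x, φ ((γ₂ : Matrix (Fin 2) (Fin 2) E) *ᵥ x) = lam * φ x)
    (u : GL (Fin 1) E) (hum : Valued.v (((u : Matrix (Fin 1) (Fin 1) E) 0 0) - 1) ≤ Valued.v (ϖ ^ mstarOfRecord d))
    {g₂ : GL (Fin 2) E} {cc x₀ : M} (hx₀ : x₀ ≠ 0)
    (hΛx : ∀ x, x ∈ (latt (g₂ : Matrix (Fin 2) (Fin 2) E)).toAddSubgroup.map φ ↔ ∃ z, IsOrd ρ α cc z ∧ x = x₀ * z)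
    (hsh : LatticeNearTransvShell ϖ (d % 2) (mcOfRecord d) ((((endoGL (γ₂, u) : GL (Fin 3) E) : Matrix (Fin 3) (Fin 3) E) - 1))
      (latt ((endoGL (g₂, (1 : GL (Fin 1) E)) : GL (Fin 3) E) : Matrix (Fin 3) (Fin 3) E))) :
    IsOrd ρ α cc ((lam - 1) / jE ϖ ^ (d % 2)) ∧ ¬ IsOrd ρ α cc ((lam - 1) / jE ϖ ^ (d % 2 + 1)) ∧ IsOrd ρ α cc ((lam - 1) ^ 2 / jE ϖ ^ mcOfRecord d) := by
  have hvϖ0 : Valued.v ϖ ≠ 0 := by rw [hϖ]; exact exp_ne_zero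
  have hϖ0 : ϖ ≠ 0 := fun h0 => by rw [h0, map_zero] at hvϖ0; exact hvϖ0 rfl
  have hc : ∀ n : ℕ, ϖ ^ n ≠ 0 := fun n => pow_ne_zero n hϖ0
  obtain ⟨hb, hpr, hg₀, hg₀1, hprg⟩ := axis_presentation ϖ g₂
  have hB := map_planeMatrix_latt_eq_inf_ker g₂
  set L := latt ((endoGL (g₂, (1 : GL (Fin 1) E)) : GL (Fin 3) E) : Matrix (Fin 3) (Fin 3) E) with hLdef
  set B₂ := latt (g₂ : Matrix (Fin 2) (Fin 2) E) with hB₂def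
  -- the two plane readings
  have hlevel : ∀ n : ℕ, LatticeInLevel ϖ n ((((endoGL (γ₂, u) : GL (Fin 3) E) : Matrix (Fin 3) (Fin 3) E) - 1)) L ↔
      Valued.v (((u : Matrix (Fin 1) (Fin 1) E) 0 0) - 1) ≤ Valued.v (ϖ ^ n) ∧ IsOrd ρ α cc ((lam - 1) / jE ϖ ^ n) := fun n => by
    rw [latticeInLevel_iff_forall, forall_endoGL_sub_one_mulVec_mem_scaleLattice_iff_plane hϖ (hc n) hb hpr hB hg₀ hg₀1 hprg γ₂ u,
      forall_smul_mulVec_mem_iff_isOrd hvρ jE φ hφs hφi hφγ rfl hx₀ hΛx (hc n), map_pow jE ϖ n]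
    simp only [Matrix.mulVec_zero, smul_zero, sub_self, Submodule.zero_mem, and_true]
  have hsquare : LatticeInLevel ϖ (mcOfRecord d) (((((endoGL (γ₂, u) : GL (Fin 3) E) : Matrix (Fin 3) (Fin 3) E) - 1)) * ((((endoGL (γ₂, u) : GL (Fin 3) E) : Matrix (Fin 3) (Fin 3) E) - 1))) L →
      IsOrd ρ α cc ((lam - 1) ^ 2 / jE ϖ ^ mcOfRecord d) := fun h => by
    rw [latticeInLevel_iff_forall, forall_endoGL_sub_one_sq_mulVec_mem_scaleLattice_iff_plane hϖ (hc _) hb hpr hB hg₀ hg₀1 hprg γ₂ u] at h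
    obtain ⟨-, h2, -⟩ := h
    -- `φ` transports `(γ₂ − 1)²` to multiplication by `(lam − 1)²`; evaluate at a preimage of `x₀`
    have hφγ2 : ∀ x, φ (((((γ₂ : Matrix (Fin 2) (Fin 2) E) - 1) * ((γ₂ : Matrix (Fin 2) (Fin 2) E) - 1))) *ᵥ x) = (lam - 1) ^ 2 * φ x := fun x => by
      rw [← Matrix.mulVec_mulVec, Matrix.sub_mulVec, Matrix.one_mulVec, map_sub, hφγ, Matrix.sub_mulVec, Matrix.one_mulVec, map_sub, hφγ]
      ring
    have hx₀Λ : x₀ ∈ B₂.toAddSubgroup.map φ := (hΛx _).2 ⟨1, isOrd_one cc, by rw [mul_one]⟩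
    rw [AddSubgroup.mem_map] at hx₀Λ
    obtain ⟨y, hyB, hyx⟩ := hx₀Λ
    have h1 := (mem_iff_map_mem φ hφi rfl _).1 (h2 y hyB)
    rw [hφs, map_inv₀, hφγ2, show φ y = x₀ from hyx] at h1
    obtain ⟨z', hz', hzz'⟩ := (hΛx _).1 h1
    have : (lam - 1) ^ 2 / jE ϖ ^ mcOfRecord d = z' := by
      have e : (jE (ϖ ^ mcOfRecord d))⁻¹ * ((lam - 1) ^ 2 * x₀) = x₀ * ((lam - 1) ^ 2 / jE ϖ ^ mcOfRecord d) := by rw [div_eq_mul_inv, map_pow]; ring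
      rw [e] at hzz'
      exact mul_left_cancel₀ hx₀ hzz'
    rwa [this]
  obtain ⟨hlev, hnlev, hsq⟩ := hsh
  refine ⟨((hlevel _).1 hlev).2, fun hord => hnlev ((hlevel _).2 ⟨hum.trans ?_, hord⟩), hsquare hsq⟩
  -- `|ϖ^{m*}| ≤ |ϖ^{ℓ₀+1}|`
  rw [map_pow, map_pow, v_varpi_pow hϖ, v_varpi_pow hϖ, exp_le_exp]
  have : d % 2 + 1 ≤ mstarOfRecord d := by unfold mstarOfRecord; omega
  omega

/-! ## §2 The `m*`-letter of the axis vertex in the line model (★ p861372 HEAD A at `b = 0`, `w₀ = 0`, `x₀ = e_W`) -/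

/-- **THE LETTER OF THE AXIS VERTEX IS THE LINE VALUE SET OF `κ·(lam − jE u₀₀)`.**  ★ (C1) block frame (`H₂`, `|hW| ≤ 1`, `Γ = ι(γ₂, u)`, `|u₀₀ − 1| ≤ |ϖ^m|`), the line model with
the ★ DEFS letters, and a plane lattice `latt g₂` presenting a member `x₀·𝒪_j` of `levelSet ρ Θ α (jE ϖ) h j a` (so the axis vertex `latt ι(g₂, 1)` is integral, ★ p862003): its
`ϖ^m`-value set of `Γ − 1` is `{z ∣ ∃ ζ ∈ 𝒪_j, |(jE ϖ^m)⁻¹(jE z − Tr_ρ(h·N_Θ x₀·(lam − jE u₀₀)·ζΘζ))| ≤ 1}`. [cite: Jacobowitz1962, §4] [cite: Rogawski1990, §4.9 Prop. 4.9.1 (b) p. 55] -/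
theorem valueSet_axis_eq_lineValueSet (hvσ : ∀ a, Valued.v (σ a) = Valued.v a) {ϖ : E} (hϖ : Valued.v ϖ = exp (-1 : ℤ))
    (H₂ : Matrix (Fin 2) (Fin 2) E) {hW : E} (hhW : Valued.v hW ≤ 1) (jE : E →+* M) (hjv : ∀ c, Valued.v (jE c) ≤ 1 ↔ Valued.v c ≤ 1)
    (hρρ : ∀ x, ρ (ρ x) = x) (hvρ : ∀ x, Valued.v (ρ x) = Valued.v x) (hα : ρ α ≠ α) (hα1 : Valued.v α ≤ 1)
    (hint : ∀ z : M, Valued.v z ≤ 1 → Valued.v ((z - ρ z) / (α - ρ α)) ≤ 1)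
    (hΘΘ : ∀ x, Θ (Θ x) = x) (hΘρ : ∀ x, Θ (ρ x) = ρ (Θ x)) (hvΘ : ∀ x, Valued.v (Θ x) = Valued.v x) (hjfix : ∀ z, ρ z = z ↔ ∃ c, jE c = z)
    (φ : (Fin 2 → E) →+ M) (hφs : ∀ (c : E) (x : Fin 2 → E), φ (c • x) = jE c * φ x)
    {γ₂ : GL (Fin 2) E} {lam h : M} (hφγ : ∀ x, φ ((γ₂ : Matrix (Fin 2) (Fin 2) E).mulVec x) = lam * φ x)
    (hh : h ≠ 0) (hform : ∀ x y, jE (pairing σ H₂ x y) = h * Θ (φ x) * φ y + ρ (h * Θ (φ x) * φ y))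
    (u : GL (Fin 1) E) (m : ℕ) (hum : Valued.v (((u : Matrix (Fin 1) (Fin 1) E) 0 0) - 1) ≤ Valued.v (ϖ ^ m))
    (j a : ℕ) {g₂ : GL (Fin 2) E} (hmem : (latt (g₂ : Matrix (Fin 2) (Fin 2) E)).toAddSubgroup.map φ ∈ levelSet ρ Θ α (jE ϖ) h j a)
    {x₀ : M} (hΛx : ∀ x, x ∈ (latt (g₂ : Matrix (Fin 2) (Fin 2) E)).toAddSubgroup.map φ ↔ ∃ z, IsOrd ρ α (jE ϖ ^ j) z ∧ x = x₀ * z) :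
    {z : E | ∃ y ∈ latt ((endoGL (g₂, (1 : GL (Fin 1) E)) : GL (Fin 3) E) : Matrix (Fin 3) (Fin 3) E),
        Valued.v ((ϖ ^ m)⁻¹ * (z - pairing σ (!![H₂ 0 0, 0, H₂ 0 1; 0, hW, 0; H₂ 1 0, 0, H₂ 1 1] : Matrix (Fin 3) (Fin 3) E) y
          (((((endoGL (γ₂, u) : GL (Fin 3) E) : Matrix (Fin 3) (Fin 3) E) - 1)) *ᵥ y))) ≤ 1} =
      {z : E | ∃ ζ : M, IsOrd ρ α (jE ϖ ^ j) ζ ∧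
        Valued.v ((jE ϖ ^ m)⁻¹ * (jE z - (h * (x₀ * Θ x₀) * (lam - jE ((u : Matrix (Fin 1) (Fin 1) E) 0 0)) * (ζ * Θ ζ) +
          ρ (h * (x₀ * Θ x₀) * (lam - jE ((u : Matrix (Fin 1) (Fin 1) E) 0 0)) * (ζ * Θ ζ))))) ≤ 1} := by
  have hvϖ0 : Valued.v ϖ ≠ 0 := by rw [hϖ]; exact exp_ne_zero
  have hϖ0 : ϖ ≠ 0 := fun h0 => by rw [h0, map_zero] at hvϖ0; exact hvϖ0 rfl
  have hϖ1 : Valued.v ϖ ≤ 1 := by rw [hϖ, ← exp_zero, exp_le_exp]; norm_num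
  obtain ⟨-, hpr, hg₀, hg₀1, hprg⟩ := axis_presentation ϖ g₂
  have hB := map_planeMatrix_latt_eq_inf_ker g₂
  have hint' := v_pairing_self_le_one_of_mem_levelSet hvσ hϖ0 hϖ1 H₂ hhW jE hρρ hvρ hα hα1 hint hΘΘ hΘρ hvΘ hjv hjfix φ hh hform j a hmem
  rw [valueSet_endoGL_sub_one_glued_eq_lineModelSet_of_v_sub_one_le σ hϖ H₂ hW jE hjv φ hφs hφγ hform hpr hint' hB hg₀ hg₀1 (w₀ := 0) hprg u m hum]
  ext z
  simp only [Set.mem_setOf_eq, smul_zero, add_zero]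
  constructor
  · rintro ⟨β, hβ, a', -, hz⟩
    have hφβ : φ β ∈ (latt (g₂ : Matrix (Fin 2) (Fin 2) E)).toAddSubgroup.map φ := ⟨β, hβ, rfl⟩
    obtain ⟨ζ, hζ, hβζ⟩ := (hΛx _).1 hφβ
    refine ⟨ζ, hζ, ?_⟩
    have e : h * Θ (φ β) * ((lam - jE ((u : Matrix (Fin 1) (Fin 1) E) 0 0)) * φ β) =
        h * (x₀ * Θ x₀) * (lam - jE ((u : Matrix (Fin 1) (Fin 1) E) 0 0)) * (ζ * Θ ζ) := by rw [hβζ, map_mul]; ring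
    rwa [e] at hz
  · rintro ⟨ζ, hζ, hz⟩
    have hxζ : x₀ * ζ ∈ (latt (g₂ : Matrix (Fin 2) (Fin 2) E)).toAddSubgroup.map φ := (hΛx _).2 ⟨ζ, hζ, rfl⟩
    obtain ⟨β, hβ, hβζ⟩ := hxζ
    refine ⟨β, hβ, 0, by rw [map_zero]; exact zero_le, ?_⟩
    have e : h * Θ (φ β) * ((lam - jE ((u : Matrix (Fin 1) (Fin 1) E) 0 0)) * φ β) =
        h * (x₀ * Θ x₀) * (lam - jE ((u : Matrix (Fin 1) (Fin 1) E) 0 0)) * (ζ * Θ ζ) := by rw [hβζ, map_mul]; ring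
    rwa [e]

/-! ## §3 HEAD — ★ p862003's `hdich` on the whole axis column (lanes A∕B) -/

/-- **HEAD — (AX-sh) «THE `hdich` OF (AX-0) HOLDS AT EVERY AXIS LEVEL» (★ p862003 ∕ ★ p862391 binder, byte shape, at `(ℓ, mc, a) = (d % 2, mcOfRecord d, 0)`).**  Frame:
★ p862003's block-frame binders (complete-free: the sheet datum `hD` on `E` with `2 ≤ d`, `H₂`, `|hW| ≤ 1`, the line model `jE ρ Θ α φ lam h` with `hφs hφi hφγ hform` and the ★ DEFS
letters, `Γ = ι(γ₂, u)` with `hum : |u₀₀ − 1| ≤ |ϖ^{m*}|`), plus the lane letters `Θ h = h`, `Θ lam·lam = 1`, `|α − ρα| = 1` (lanes A = Unr-K, B = RamK), `|jE a| = |a|`.  THEN for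
every level `j` and every `g₂` with `φ(latt g₂) ∈ levelSet ρ Θ α (jE ϖ) h j 0` whose axis vertex `latt ι(g₂, 1)` lies on the shell `(d % 2, mcOfRecord d)` of `Γ − 1`, there is a
`σ`-FIXED UNIT `e` with `VS_{m*}(latt ι(g₂, 1)) = valueSetMod σ ϖ (mstarOfRecord d) (e • xPlus σ ϖ d)` — §2 ∘ §1 ∘ ★ 2∕3 `exists_fixed_unit_lineValueSet_axis_eq_smul_xPlus` (the `κ`
of the cell from `Y = κ·ϖE^j(α − ρα)`, `|Y| = 1`, `Y ∈ 𝒪_j`; the six inequalities at `m = m*`, `2k = m_c` by `omega`).  No depth hypothesis: deep AND shallow orders.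
[cite: Rogawski1990, §4.9 Prop. 4.9.1 (b) p. 55] [cite: Jacobowitz1962, §4] [cite: Kottwitz1986BaseChangeUnits, §1 pp. 240–241] [cite: Serre1979, Ch. III §3 Prop. 7, Ch. V §3 Cor. 3] -/
theorem exists_fixed_unit_valueSet_axis_eq_smul_xPlus (hD : IsRamifiedQuadraticDatum σ ϖ d t) (h2d : 2 ≤ d)
    (H₂ : Matrix (Fin 2) (Fin 2) E) {hW : E} (hhW : Valued.v hW ≤ 1) (jE : E →+* M) (hjiso : ∀ a, Valued.v (jE a) = Valued.v a)
    (hρρ : ∀ x, ρ (ρ x) = x) (hvρ : ∀ x, Valued.v (ρ x) = Valued.v x) (hα1 : Valued.v α ≤ 1) (hαρ : Valued.v (α - ρ α) = 1)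
    (hint : ∀ z : M, Valued.v z ≤ 1 → Valued.v ((z - ρ z) / (α - ρ α)) ≤ 1)
    (hΘΘ : ∀ x, Θ (Θ x) = x) (hΘρ : ∀ x, Θ (ρ x) = ρ (Θ x)) (hvΘ : ∀ x, Valued.v (Θ x) = Valued.v x)
    (hjfix : ∀ z, ρ z = z ↔ ∃ c, jE c = z) (hΘj : ∀ x, Θ (jE x) = jE (σ x))
    (φ : (Fin 2 → E) →+ M) (hφs : ∀ (c : E) (x : Fin 2 → E), φ (c • x) = jE c * φ x) (hφi : Function.Injective φ)
    {γ₂ : GL (Fin 2) E} {lam h : M} (hφγ : ∀ x, φ ((γ₂ : Matrix (Fin 2) (Fin 2) E).mulVec x) = lam * φ x) (hlam : Θ lam * lam = 1)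
    (hh : h ≠ 0) (hΘh : Θ h = h) (hform : ∀ x y, jE (pairing σ H₂ x y) = h * Θ (φ x) * φ y + ρ (h * Θ (φ x) * φ y))
    (u : GL (Fin 1) E) (hum : Valued.v (((u : Matrix (Fin 1) (Fin 1) E) 0 0) - 1) ≤ Valued.v (ϖ ^ mstarOfRecord d))
    (j : ℕ) {g₂ : GL (Fin 2) E} (hmem : (latt (g₂ : Matrix (Fin 2) (Fin 2) E)).toAddSubgroup.map φ ∈ levelSet ρ Θ α (jE ϖ) h j 0)
    (hsh : LatticeNearTransvShell ϖ (d % 2) (mcOfRecord d) ((((endoGL (γ₂, u) : GL (Fin 3) E) : Matrix (Fin 3) (Fin 3) E) - 1))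
      (latt ((endoGL (g₂, (1 : GL (Fin 1) E)) : GL (Fin 3) E) : Matrix (Fin 3) (Fin 3) E))) :
    ∃ e : E, σ e = e ∧ Valued.v e = 1 ∧
      {z : E | ∃ y ∈ latt ((endoGL (g₂, (1 : GL (Fin 1) E)) : GL (Fin 3) E) : Matrix (Fin 3) (Fin 3) E),
          Valued.v ((ϖ ^ (mstarOfRecord d))⁻¹ * (z - pairing σ (!![H₂ 0 0, 0, H₂ 0 1; 0, hW, 0; H₂ 1 0, 0, H₂ 1 1] : Matrix (Fin 3) (Fin 3) E) y
            (((((endoGL (γ₂, u) : GL (Fin 3) E) : Matrix (Fin 3) (Fin 3) E) - 1)) *ᵥ y))) ≤ 1} =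
        valueSetMod σ ϖ (mstarOfRecord d) (e • xPlus σ ϖ d) := by
  have hvσ : ∀ a, Valued.v (σ a) = Valued.v a := hD.2.1
  have hϖ : Valued.v ϖ = exp (-1 : ℤ) := hD.2.2.1
  have h1d : 1 ≤ d := hD.2.2.2.2.2.1
  have hjv : ∀ c, Valued.v (jE c) ≤ 1 ↔ Valued.v c ≤ 1 := fun c => by rw [hjiso]
  have hα : ρ α ≠ α := fun h0 => by rw [h0, sub_self, map_zero] at hαρ; exact zero_ne_one hαρ
  -- the cell presentation: `Λ = x₀·𝒪_j`, `Y = κ·ϖE^j(α − ρα)` a unit of `𝒪_j`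
  obtain ⟨x₀, hx₀, hΛx, hYO, -, hYv⟩ := (mem_levelSet_iff ρ Θ α (jE ϖ) h j 0 _).1 hmem
  set κ : M := h * (x₀ * Θ x₀) with hκdef
  have hY : dualGen ρ Θ α (jE ϖ ^ j) h x₀ = κ * (jE ϖ ^ j * (α - ρ α)) := by rw [dualGen_def]
  have hcc := v_map_varpi_pow hϖ jE hjiso j
  have hΘκ : Θ κ = κ := by rw [hκdef, map_mul, map_mul, hΘh, hΘΘ]; ring
  clear_value κ
  have hκj : Valued.v κ * Valued.v (jE ϖ) ^ j = 1 := by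
    have e : Valued.v (dualGen ρ Θ α (jE ϖ ^ j) h x₀) = Valued.v κ * Valued.v (jE ϖ) ^ j := by
      rw [hY, Valuation.map_mul _ κ, Valuation.map_mul _ (jE ϖ ^ j), hαρ, mul_one, Valuation.map_pow]
    rw [← e, hYv, pow_zero]
  have hκρ : Valued.v (κ + ρ κ) ≤ 1 := by
    have hρϖ : ρ (jE ϖ) = jE ϖ := (hjfix _).2 ⟨ϖ, rfl⟩
    have hne : Valued.v (jE ϖ ^ j * (α - ρ α)) ≠ 0 := by rw [map_mul, hαρ, mul_one, hcc]; exact exp_ne_zero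
    have h2 := ((isOrd_iff _ _ _ _).1 hYO).2
    have e : dualGen ρ Θ α (jE ϖ ^ j) h x₀ - ρ (dualGen ρ Θ α (jE ϖ ^ j) h x₀) = (κ + ρ κ) * (jE ϖ ^ j * (α - ρ α)) := by
      rw [hY]; simp only [map_mul, map_sub, map_pow, hρϖ, hρρ]; ring
    rw [e, Valuation.map_mul _ (κ + ρ κ), ← le_div_iff₀ (zero_lt_iff.2 hne), div_self hne] at h2
    exact h2
  -- the shell as order tokens, and the letter in the line model
  obtain ⟨hlev, hnlev, hsq⟩ := isOrd_tokens_of_shell hϖ h1d hvρ jE φ hφs hφi hφγ u hum hx₀ hΛx hsh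
  rw [valueSet_axis_eq_lineValueSet hvσ hϖ H₂ hhW jE hjv hρρ hvρ hα hα1 hint hΘΘ hΘρ hvΘ hjfix φ hφs hφγ hh hform u (mstarOfRecord d) hum j 0 hmem hΛx]
  -- the six inequalities at the letters of record
  have hmc : mcOfRecord d = 2 * ((mstarOfRecord d + d) / 2) := rfl
  have hm : mstarOfRecord d = d % 2 + 2 * d - 1 := rfl
  rw [hmc] at hsq
  rw [← hκdef]
  exact exists_fixed_unit_lineValueSet_axis_eq_smul_xPlus hD jE hjiso hjfix hΘj hρρ hvρ hΘΘ hΘρ hvΘ hα1 hαρ hΘκ hκρ hκj hlam hum hlev hnlev hsq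
    (by omega) (by omega) (by omega) (by omega) (by omega) (by omega)

end Summit.HodgeConjecture.HodgeConjecture.Cruxes.H413.F0P3cDyRamAxisLetterOneClass

end
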